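import Summits.QuantumFields.BalabanUV.Beta.EriceRemainderEnclosureHistoryAutonomyComparisonNonlinearLevelGauge

/-!
# EriceRemainderEnclosureHistoryAutonomyComparisonNonlinearModulusPrep — (E119b) preparations for THE NONLINEAR LEVEL GAUGE FOR AN ISOTONE EXCESS OF SMALL MODULUS.
# Base `B u = β₀ + Σ_{k<K} L_k·u_k` (`β₀ > 0`, `L ≥ 0`, `L_0 = 0`; any profile, any size); perturbation `B′ ≥ B` with a modulus `M′`, ISOTONE excess `E = B′ − B ≥ 0`
# whose modulus along ordered pairs is `ME ≥ 0` — the setting of (E118b) `row_ge`.  Along the base orbit `h = S y`: `X_m = B′(S′h_m) − B(S h_m)`, `e_m = E(S′h_m)`,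
# `a_m = 1∕h_m²`.  §1 `excess_facts` (`B′` isotone with floor `β₀`), **`cmp_of_steps_nonneg`** (non-negative deeper step quantities ⟹ every configuration compares),
# **`excess_orbit_antitone`** (`0 ≤ e_{m+1} ≤ e_m`: pin monotonicity + isotone excess).  §2 `step_le_excess` (`X_m ≤ e_m`), `conf_gap_le_excess` (`δ^{(m)}_k ≤ k·e_{m+1}`),
# **`step_ge_excess`** (`X_m ≥ e_m − T(m)·e_{m+1}`).  §3 **`defect_mod_le`** — THE EXCESS-MODULUS DEFECT FITS THE SPARE TWENTIETH: with the window through the gauge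
# (`S ≤ ε1·h_{n+1}²·Σ_{1≤l<k} a_{n+1+l}`) and **`ME·γ ≤ β₀∕5`**,  `c_{n+1,k}·(ME·h³_{n+k+1}∕2)·S ≤ (1∕20)·β_k h_{n+1}²·ε1`  (`(k−1)∕a_{n+1+k} ≤ 1∕β₀` because the levels grow
# at least linearly; `h ≤ γ`).  The sequels (E119c∕d) run (E118d∕e)'s base and induction with these in place of the constant-excess facts.

Cell `pub-balaban`, β-function sub-cell, BINDER row D4 «RemainderConst leaves for Bałaban's split» (`HOME/BINDER-OWNERS.md`; owner lineage `b2b-balaban-beta-an4`;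
this file by co-owner #2 lineage `b2b-balaban-beta-d4-p2`, generation 98), β-FLOW TEAM duty (1), FREEZE (0) honoured (def-free; imports (E118e); uses (E118a)
`affine_facts` ∕ `step_eq_drop` ∕ `sum_range_eq_Ico_of_zero`, (E63a) `levelGap_le_sum_step`, (E49k) `family_le_of_orbit`, (E48a) `family_mem` ∕ `family_tail_eq` ∕ `family_zero`
∕ `le_of_pin_le` ∕ `strictAnti_of_memFlow`, node U2's `invSq_eq_of_memFlow` ∕ `mul_lower_le_drive` ∕ `Sharpness.abs_sub_le_half_cube_mul` BY NAME; nothing restated).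

HONEST FRAMING (page 1, verbatim and binding).  *"Discharging BetaPertH makes Bałaban's UV stability UNCONDITIONAL — a real constructive-QFT result; it is
NOT the continuum limit and NOT the Clay problem."*  THIS FILE DISCHARGES NOTHING OF THE KIND.  Elementary real analysis about ABSTRACT functionals on a box
]0,γ]^ℕ with displayed floors, moduli, profiles and signs — hypotheses of a census, not facts; the form, signs, ages and moments of Bałaban's (1.22) limit
functional are NOT PRINTED ([I] p. 298; GAPS G-t4-U2-1∕-2) and NOT asserted.  Row D4 class UNCHANGED (critical-path width 0; instance 0∕1; D4 DISCHARGE NO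
DATE).  HONEST DEPENDENCY: continuum YM on T⁴ ⇐ BetaPertH ∧ nine spine estimates (0/9 proved); BetaPertH ⇐ (D1) ∧ (D4) ∧ CAP+tail; G-an2-4 gates asym, D1
and NE2/3/4.  NOT CLAIMED here: the comparison theorem itself (the sequel); anything printed — NOT B12 Thm 2, NOT BetaPertH, NOT continuum, NOT Clay.

WHAT IS PROVED ([folklore]; 0 `def`, 0 sorry).  §1 `excess_facts`, **`cmp_of_steps_nonneg`**, **`excess_orbit_antitone`**.  §2 `step_le_excess`, `conf_gap_le_excess`,
**`step_ge_excess`**.  §3 **`defect_mod_le`**.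
-/

noncomputable section
open Finset Set

namespace Summit.QuantumFields.BalabanUV.Beta.EriceRemainderEnclosureHistoryAutonomyComparisonNonlinearModulusPrep

open Literature.MathematicalPhysics.QuantumFieldTheory.Balaban1983to89
open Literature.MathematicalPhysics.QuantumFieldTheory.Balaban1983to89.T4BetaStationary
open Literature.MathematicalPhysics.QuantumFieldTheory.Balaban1983to89.T4BetaFlowWellPosed
open Literature.MathematicalPhysics.QuantumFieldTheory.Balaban1983to89.T4BetaFlowWellPosed.Sharpness (abs_sub_le_half_cube_mul)
open Summit.QuantumFields.BalabanUV.Beta.EriceRemainderEnclosureHistoryAutonomyOrder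
  (family_mem family_tail_eq family_zero le_of_pin_le strictAnti_of_memFlow)
open Summit.QuantumFields.BalabanUV.Beta.EriceRemainderEnclosureHistoryAutonomyComparisonIsotoneExcess (family_le_of_orbit)
open Summit.QuantumFields.BalabanUV.Beta.EriceRemainderEnclosureHistoryAutonomyComparisonDropBound (levelGap_le_sum_step)
open Summit.QuantumFields.BalabanUV.Beta.EriceRemainderEnclosureHistoryAutonomyComparisonNonlinearRowPrep (affine_facts step_eq_drop sum_range_eq_Ico_of_zero)

variable {B B' : (ℕ → ℝ) → ℝ} {γ β₀ M' ME : ℝ} {L : ℕ → ℝ} {K : ℕ} {S S' : ℝ → ℕ → ℝ}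

/-! ## §1 The perturbed functional, comparison from deeper steps, the excess along the orbit -/

/-- `B′ = B + E` with `E ≥ 0` isotone over the affine memory: `B′` is isotone and has the floor `β₀`. [folklore] -/
theorem excess_facts (hBaff : ∀ u, SeqBox γ u → B u = β₀ + ∑ k ∈ range K, L k * u k) (hL : ∀ k, 0 ≤ L k) (hβ : 0 < β₀)
    (hexc : ∀ u, SeqBox γ u → B u ≤ B' u)
    (hDmono : ∀ u v : ℕ → ℝ, SeqBox γ u → SeqBox γ v → (∀ j, u j ≤ v j) → B' u - B u ≤ B' v - B v) :
    (∀ u v : ℕ → ℝ, SeqBox γ u → SeqBox γ v → (∀ j, u j ≤ v j) → B' u ≤ B' v) ∧ (∀ u, SeqBox γ u → β₀ ≤ B' u) := by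
  obtain ⟨hmono, hlo, _, _⟩ := affine_facts hBaff hL hβ
  exact ⟨fun u v hu hv hle => by have := hDmono u v hu hv hle; have := hmono u v hu hv hle; linarith,
    fun u hu => (hlo u hu).trans (hexc u hu)⟩

/-- **COMPARISON FROM NON-NEGATIVE DEEPER STEP QUANTITIES** (general perturbation with a modulus): if `X_m ≥ 0` at every orbit pin `h_m`, `m ≥ n+1`, then every
configuration `m ≥ n` compares, `S′(h_m)_j ≤ h_{m+j}` ((E49k) `family_le_of_orbit`). [folklore] -/
theorem cmp_of_steps_nonneg (hBaff : ∀ u, SeqBox γ u → B u = β₀ + ∑ k ∈ range K, L k * u k) (hL : ∀ k, 0 ≤ L k) (hβ : 0 < β₀)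
    (hB' : ∀ u u' : ℕ → ℝ, SeqBox γ u → SeqBox γ u' → ∀ D : ℝ, (∀ j, |u j - u' j| ≤ D) → |B' u - B' u'| ≤ M' * D) (hM' : 0 ≤ M')
    (hexc : ∀ u, SeqBox γ u → B u ≤ B' u)
    (hDmono : ∀ u v : ℕ → ℝ, SeqBox γ u → SeqBox γ v → (∀ j, u j ≤ v j) → B' u - B u ≤ B' v - B v)
    (hS : ∀ p, 0 < p → p ≤ γ → SeqBox γ (S p) ∧ MemFlow B p (S p))
    (huniq : ∀ p, 0 < p → p ≤ γ → ∀ u u' : ℕ → ℝ, SeqBox γ u → SeqBox γ u' → MemFlow B p u → MemFlow B p u' → u = u')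
    (hS' : ∀ p, 0 < p → p ≤ γ → SeqBox γ (S' p) ∧ MemFlow B' p (S' p))
    (huniq' : ∀ p, 0 < p → p ≤ γ → ∀ u u' : ℕ → ℝ, SeqBox γ u → SeqBox γ u' → MemFlow B' p u → MemFlow B' p u' → u = u')
    {y : ℝ} (hy : 0 < y) (hyγ : y ≤ γ) (n : ℕ) (hX : ∀ m, n + 1 ≤ m → 0 ≤ B' (S' (S y m)) - B (S (S y m))) :
    ∀ m, n ≤ m → ∀ j, S' (S y m) j ≤ S y (m + j) := by
  obtain ⟨_, hlo'⟩ := excess_facts hBaff hL hβ hexc hDmono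
  intro m hm j
  have hq := family_mem hS hy hyγ m
  have hγ : 0 < γ := hy.trans_le hyγ
  have htail : ∀ i, S (S y m) i = S y (m + i) := fun i => (congrFun (family_tail_eq hS huniq hy hyγ m) i).symm
  have hQ : ∀ i, 1 ≤ i → B (S (S (S y m) i)) ≤ B' (S' (S (S y m) i)) := by
    intro i hi; rw [htail i]; linarith [hX (m + i) (by omega)]
  have := family_le_of_orbit hβ hγ hB' hM' hlo' hS huniq hS' huniq' ⟨hq.1, hq.2⟩ hQ j
  rwa [htail j] at this

/-- **THE EXCESS SEEN AT THE CONFIGURATIONS' PINS IS NON-NEGATIVE AND NON-INCREASING ALONG THE ORBIT**: `0 ≤ e_{m+1} ≤ e_m`, `e_m = (B′ − B)(S′h_m)` (the pins decrease,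
the `B′`-family is monotone in the pin, the excess is isotone). [folklore] -/
theorem excess_orbit_antitone (hBaff : ∀ u, SeqBox γ u → B u = β₀ + ∑ k ∈ range K, L k * u k) (hL : ∀ k, 0 ≤ L k) (hβ : 0 < β₀)
    (hB' : ∀ u u' : ℕ → ℝ, SeqBox γ u → SeqBox γ u' → ∀ D : ℝ, (∀ j, |u j - u' j| ≤ D) → |B' u - B' u'| ≤ M' * D) (hM' : 0 ≤ M')
    (hexc : ∀ u, SeqBox γ u → B u ≤ B' u)
    (hDmono : ∀ u v : ℕ → ℝ, SeqBox γ u → SeqBox γ v → (∀ j, u j ≤ v j) → B' u - B u ≤ B' v - B v)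
    (hS : ∀ p, 0 < p → p ≤ γ → SeqBox γ (S p) ∧ MemFlow B p (S p))
    (hS' : ∀ p, 0 < p → p ≤ γ → SeqBox γ (S' p) ∧ MemFlow B' p (S' p))
    (huniq' : ∀ p, 0 < p → p ≤ γ → ∀ u u' : ℕ → ℝ, SeqBox γ u → SeqBox γ u' → MemFlow B' p u → MemFlow B' p u' → u = u')
    {y : ℝ} (hy : 0 < y) (hyγ : y ≤ γ) (m : ℕ) :
    0 ≤ B' (S' (S y (m + 1))) - B (S' (S y (m + 1)))
      ∧ B' (S' (S y (m + 1))) - B (S' (S y (m + 1))) ≤ B' (S' (S y m)) - B (S' (S y m)) := by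
  obtain ⟨hmono, hlo, _, _⟩ := affine_facts hBaff hL hβ
  obtain ⟨_, hlo'⟩ := excess_facts hBaff hL hβ hexc hDmono
  have hq := family_mem hS hy hyγ m
  have hq1 := family_mem hS hy hyγ (m + 1)
  have hanti := (strictAnti_of_memFlow hβ hlo (hS y hy hyγ).1 (hS y hy hyγ).2).antitone
  have hpin : S y (m + 1) ≤ S y m := hanti (Nat.le_succ m)
  have hk := hS' _ hq.1 hq.2
  have hk1 := hS' _ hq1.1 hq1.2
  have hle : ∀ j, S' (S y (m + 1)) j ≤ S' (S y m) j := fun j => le_of_pin_le hβ hB' hM' hlo' huniq' hq1.1 hpin hq.2 hk1.1 hk.1 hk1.2 hk.2 j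
  exact ⟨by linarith [hexc _ hk1.1], hDmono _ _ hk1.1 hk.1 hle⟩

/-! ## §2 The step quantity between `e_m − T(m)·e_{m+1}` and `e_m` -/

/-- Under comparison in configuration `m`, `X_m ≤ e_m`. [folklore] -/
theorem step_le_excess (hBaff : ∀ u, SeqBox γ u → B u = β₀ + ∑ k ∈ range K, L k * u k) (hL : ∀ k, 0 ≤ L k)
    (hS : ∀ p, 0 < p → p ≤ γ → SeqBox γ (S p) ∧ MemFlow B p (S p))
    (huniq : ∀ p, 0 < p → p ≤ γ → ∀ u u' : ℕ → ℝ, SeqBox γ u → SeqBox γ u' → MemFlow B p u → MemFlow B p u' → u = u')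
    (hS' : ∀ p, 0 < p → p ≤ γ → SeqBox γ (S' p) ∧ MemFlow B' p (S' p))
    {y : ℝ} (hy : 0 < y) (hyγ : y ≤ γ) (m : ℕ) (hcmp : ∀ j, S' (S y m) j ≤ S y (m + j)) :
    B' (S' (S y m)) - B (S (S y m)) ≤ B' (S' (S y m)) - B (S' (S y m)) := by
  rw [step_eq_drop hBaff hS huniq hS' hy hyγ m]
  have : 0 ≤ ∑ k ∈ range K, L k * (S y (m + k) - S' (S y m) k) := sum_nonneg fun k _ => mul_nonneg (hL k) (by linarith [hcmp k])
  linarith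

/-- Under comparison from every pin `h_{m′}`, `m′ ≥ m`, the level gap of configuration `m` at depth `k` is at most `k·e_{m+1}` ((E63a) `levelGap_le_sum_step`, `step_le_excess`
at the deeper pins, `e` non-increasing). [folklore] -/
theorem conf_gap_le_excess (hBaff : ∀ u, SeqBox γ u → B u = β₀ + ∑ k ∈ range K, L k * u k) (hL : ∀ k, 0 ≤ L k) (hβ : 0 < β₀)
    (hB' : ∀ u u' : ℕ → ℝ, SeqBox γ u → SeqBox γ u' → ∀ D : ℝ, (∀ j, |u j - u' j| ≤ D) → |B' u - B' u'| ≤ M' * D) (hM' : 0 ≤ M')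
    (hexc : ∀ u, SeqBox γ u → B u ≤ B' u)
    (hDmono : ∀ u v : ℕ → ℝ, SeqBox γ u → SeqBox γ v → (∀ j, u j ≤ v j) → B' u - B u ≤ B' v - B v)
    (hS : ∀ p, 0 < p → p ≤ γ → SeqBox γ (S p) ∧ MemFlow B p (S p))
    (huniq : ∀ p, 0 < p → p ≤ γ → ∀ u u' : ℕ → ℝ, SeqBox γ u → SeqBox γ u' → MemFlow B p u → MemFlow B p u' → u = u')
    (hS' : ∀ p, 0 < p → p ≤ γ → SeqBox γ (S' p) ∧ MemFlow B' p (S' p))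
    (huniq' : ∀ p, 0 < p → p ≤ γ → ∀ u u' : ℕ → ℝ, SeqBox γ u → SeqBox γ u' → MemFlow B' p u → MemFlow B' p u' → u = u')
    {y : ℝ} (hy : 0 < y) (hyγ : y ≤ γ) (m : ℕ) (hcmp : ∀ m', m ≤ m' → ∀ j, S' (S y m') j ≤ S y (m' + j)) (k : ℕ) :
    1 / S' (S y m) k ^ 2 - 1 / S y (m + k) ^ 2 ≤ (k : ℝ) * (B' (S' (S y (m + 1))) - B (S' (S y (m + 1)))) := by
  obtain ⟨hmono', hlo'⟩ := excess_facts hBaff hL hβ hexc hDmono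
  have hq := family_mem hS hy hyγ m
  have htail : ∀ i, S (S y m) i = S y (m + i) := fun i => (congrFun (family_tail_eq hS huniq hy hyγ m) i).symm
  have hle : ∀ j, S' (S y m) j ≤ S (S y m) j := fun j => by rw [htail j]; exact hcmp m le_rfl j
  have h1 := levelGap_le_sum_step hmono' hβ hB' hM' hlo' hS huniq hS' huniq' (hS _ hq.1 hq.2).1 (hS _ hq.1 hq.2).2
    (hS' _ hq.1 hq.2).1 (hS' _ hq.1 hq.2).2 hle k
  rw [htail k] at h1
  refine h1.trans ?_
  -- each deeper step quantity is ≤ its excess ≤ e_{m+1}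
  have hanti : ∀ d i, B' (S' (S y (i + d))) - B (S' (S y (i + d))) ≤ B' (S' (S y i)) - B (S' (S y i)) := by
    intro d
    induction d with
    | zero => intro i; simp
    | succ d ih =>
      intro i
      have := (excess_orbit_antitone hBaff hL hβ hB' hM' hexc hDmono hS hS' huniq' hy hyγ (i + d)).2
      rw [show i + (d + 1) = i + d + 1 by ring]
      exact this.trans (ih i)
  have hterm : ∀ l ∈ range k, B' (S' (S (S y m) (l + 1))) - B (S (S (S y m) (l + 1))) ≤ B' (S' (S y (m + 1))) - B (S' (S y (m + 1))) := by
    intro l _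
    rw [htail (l + 1)]
    have h2 := step_le_excess hBaff hL hS huniq hS' hy hyγ (m + (l + 1)) (hcmp (m + (l + 1)) (by omega))
    have h3 := hanti l (m + 1)
    rw [show m + 1 + l = m + (l + 1) by ring] at h3
    exact h2.trans h3
  calc ∑ l ∈ range k, (B' (S' (S (S y m) (l + 1))) - B (S (S (S y m) (l + 1))))
      ≤ ∑ l ∈ range k, (B' (S' (S y (m + 1))) - B (S' (S y (m + 1)))) := sum_le_sum hterm
    _ = (k : ℝ) * (B' (S' (S y (m + 1))) - B (S' (S y (m + 1)))) := by rw [sum_const, card_range, nsmul_eq_mul]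

/-- **`X_m ≥ e_m − T(m)·e_{m+1}`** (`T(m) = Σ_{1≤k<K} k·L_kh_{m+k}³∕2`), under comparison from every pin `h_{m′}`, `m′ ≥ m`. [folklore] -/
theorem step_ge_excess (hBaff : ∀ u, SeqBox γ u → B u = β₀ + ∑ k ∈ range K, L k * u k) (hL : ∀ k, 0 ≤ L k) (hβ : 0 < β₀)
    (hB' : ∀ u u' : ℕ → ℝ, SeqBox γ u → SeqBox γ u' → ∀ D : ℝ, (∀ j, |u j - u' j| ≤ D) → |B' u - B' u'| ≤ M' * D) (hM' : 0 ≤ M')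
    (hexc : ∀ u, SeqBox γ u → B u ≤ B' u)
    (hDmono : ∀ u v : ℕ → ℝ, SeqBox γ u → SeqBox γ v → (∀ j, u j ≤ v j) → B' u - B u ≤ B' v - B v)
    (hS : ∀ p, 0 < p → p ≤ γ → SeqBox γ (S p) ∧ MemFlow B p (S p))
    (huniq : ∀ p, 0 < p → p ≤ γ → ∀ u u' : ℕ → ℝ, SeqBox γ u → SeqBox γ u' → MemFlow B p u → MemFlow B p u' → u = u')
    (hS' : ∀ p, 0 < p → p ≤ γ → SeqBox γ (S' p) ∧ MemFlow B' p (S' p))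
    (huniq' : ∀ p, 0 < p → p ≤ γ → ∀ u u' : ℕ → ℝ, SeqBox γ u → SeqBox γ u' → MemFlow B' p u → MemFlow B' p u' → u = u')
    {y : ℝ} (hy : 0 < y) (hyγ : y ≤ γ) (m : ℕ) (hcmp : ∀ m', m ≤ m' → ∀ j, S' (S y m') j ≤ S y (m' + j)) :
    (B' (S' (S y m)) - B (S' (S y m))) - (∑ k ∈ Ico 1 K, (k : ℝ) * (L k * S y (m + k) ^ 3 / 2)) * (B' (S' (S y (m + 1))) - B (S' (S y (m + 1))))
      ≤ B' (S' (S y m)) - B (S (S y m)) := by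
  have hq := family_mem hS hy hyγ m
  have hpos : ∀ j, 0 < S y j := fun j => ((hS y hy hyγ).1 j).1
  have hw := hS' _ hq.1 hq.2
  have he1 := (excess_orbit_antitone hBaff hL hβ hB' hM' hexc hDmono hS hS' huniq' hy hyγ m).1
  set e1 : ℝ := B' (S' (S y (m + 1))) - B (S' (S y (m + 1))) with he1def
  rw [step_eq_drop hBaff hS huniq hS' hy hyγ m,
    sum_range_eq_Ico_of_zero (f := fun k => L k * (S y (m + k) - S' (S y m) k)) (by simp [family_zero hS' hq.1 hq.2]), sum_mul]
  have hterm : ∀ k ∈ Finset.Ico 1 K, L k * (S y (m + k) - S' (S y m) k) ≤ (k : ℝ) * (L k * S y (m + k) ^ 3 / 2) * e1 := by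
    intro k _
    have hc := hcmp m le_rfl k
    have h1 := hpos (m + k); have h2 := (hw.1 k).1
    have habs := abs_sub_le_half_cube_mul h1 h2 le_rfl hc
    have hg0 : 0 ≤ S y (m + k) - S' (S y m) k := by linarith
    have hd0 : 0 ≤ 1 / S' (S y m) k ^ 2 - 1 / S y (m + k) ^ 2 :=
      sub_nonneg.mpr (one_div_le_one_div_of_le (pow_pos h2 2) (pow_le_pow_left₀ h2.le hc 2))
    rw [abs_of_nonneg hg0, abs_sub_comm, abs_of_nonneg hd0] at habs
    have hgap := conf_gap_le_excess hBaff hL hβ hB' hM' hexc hDmono hS huniq hS' huniq' hy hyγ m hcmp k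
    have := habs.trans (mul_le_mul_of_nonneg_left hgap (by positivity))
    calc L k * (S y (m + k) - S' (S y m) k) ≤ L k * (S y (m + k) ^ 3 / 2 * ((k : ℝ) * e1)) := mul_le_mul_of_nonneg_left this (hL k)
      _ = (k : ℝ) * (L k * S y (m + k) ^ 3 / 2) * e1 := by ring
  linarith [sum_le_sum hterm]

/-! ## §3 The excess-modulus defect fits the spare twentieth -/

/-- **THE EXCESS-MODULUS DEFECT AT AN AGE `k ≥ 1` IS AT MOST A TWENTIETH OF ITS SHARE**, when `ME·γ ≤ β₀∕5`: along a box solution `h` of a memory with floor `β₀` from the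
pin `y`, with the interior window bounded through the gauge (`0 ≤ S ≤ ε1·h_{n+1}²·Σ_{1≤l<k} a_{n+1+l}`, `ε1 ≥ 0`),
`(L_kh_{n+1+k}³∕2)·(ME·h_{n+k+1}³∕2)·S ≤ (1∕20)·L_kh_{n+1+k}·h_{n+1}²·ε1` — every window level is `≤ a_{n+k} ≤ a_{n+1+k}`, `h_{n+1+k} ≤ γ`, and `(k−1)∕a_{n+1+k} ≤ 1∕β₀`
since `a_j ≥ j·β₀`. [folklore] -/
theorem defect_mod_le {h : ℕ → ℝ} {y : ℝ} (hL : ∀ k, 0 ≤ L k) (hβ : 0 < β₀) (hlo : ∀ u, SeqBox γ u → β₀ ≤ B u)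
    (hh : SeqBox γ h) (hf : MemFlow B y h) (hME : 0 ≤ ME) (hMEγ : ME * γ ≤ β₀ / 5)
    (n : ℕ) {k : ℕ} (hk : 1 ≤ k) {S ε1 : ℝ} (hε1 : 0 ≤ ε1) (hS0 : 0 ≤ S) (hS : S ≤ ε1 * h (n + 1) ^ 2 * ∑ l ∈ Ico 1 k, 1 / h (n + 1 + l) ^ 2) :
    L k * h (n + 1 + k) ^ 3 / 2 * (ME * h (n + k + 1) ^ 3 / 2) * S ≤ 1 / 20 * (L k * h (n + 1 + k) * h (n + 1) ^ 2 * ε1) := by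
  have hpos : ∀ j, 0 < h j := fun j => (hh j).1
  have hanti := (strictAnti_of_memFlow hβ hlo hh hf).antitone
  have hγ : h (n + k + 1) ≤ γ := (hh _).2
  have hx := hpos (n + 1 + k)
  rw [show n + k + 1 = n + 1 + k by ring] at hγ ⊢
  -- the level at n+1+k is at least (k+1) β₀ ≥ (k−1) β₀
  have hlev : ((n + 1 + k : ℕ) : ℝ) * β₀ ≤ 1 / h (n + 1 + k) ^ 2 := by
    rw [invSq_eq_of_memFlow hf (n + 1 + k)]
    have := mul_lower_le_drive hlo hh (n + 1 + k)
    have : 0 ≤ 1 / y ^ 2 := by positivity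
    linarith
  have hkm1 : ((k : ℝ) - 1) * β₀ ≤ 1 / h (n + 1 + k) ^ 2 := by
    have : ((k : ℝ) - 1) * β₀ ≤ ((n + 1 + k : ℕ) : ℝ) * β₀ := by
      apply mul_le_mul_of_nonneg_right _ hβ.le; push_cast; linarith
    exact this.trans hlev
  -- the window: Σ_{l<k} a_{n+1+l} ≤ (k−1) a_{n+1+k}
  have hwin : ∑ l ∈ Ico 1 k, 1 / h (n + 1 + l) ^ 2 ≤ ((k : ℝ) - 1) * (1 / h (n + 1 + k) ^ 2) := by
    calc ∑ l ∈ Ico 1 k, 1 / h (n + 1 + l) ^ 2 ≤ ∑ l ∈ Ico 1 k, 1 / h (n + 1 + k) ^ 2 :=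
          sum_le_sum fun l hl => one_div_le_one_div_of_le (pow_pos hx 2)
            (pow_le_pow_left₀ hx.le (hanti (by have := (mem_Ico.mp hl).2; omega)) 2)
      _ = ((k : ℝ) - 1) * (1 / h (n + 1 + k) ^ 2) := by
          rw [sum_const, Nat.card_Ico, nsmul_eq_mul]; push_cast [hk]; ring
  have hS' : S ≤ ε1 * h (n + 1) ^ 2 * (((k : ℝ) - 1) * (1 / h (n + 1 + k) ^ 2)) :=
    hS.trans (mul_le_mul_of_nonneg_left hwin (by positivity))
  -- h³ ≤ γ h²
  have h3 : h (n + 1 + k) ^ 3 ≤ γ * h (n + 1 + k) ^ 2 := by nlinarith [pow_pos hx 2]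
  have hMEh : ME * h (n + 1 + k) ^ 3 / 2 ≤ ME * γ * h (n + 1 + k) ^ 2 / 2 := by nlinarith [mul_le_mul_of_nonneg_left h3 hME]
  -- assemble: LHS ≤ (L h)(h²/2)(MEγ h²/2) ε1 h(n+1)² (k−1)/h(n+1+k)²... = L h · h(n+1)² ε1 · MEγ (k−1) h² /4 ≤ L h h(n+1)² ε1 · (β₀/5)(1/β₀)/4
  have hx2 : 0 < h (n + 1 + k) ^ 2 := pow_pos hx 2
  have hkey : ME * γ * (((k : ℝ) - 1) * h (n + 1 + k) ^ 2) ≤ 1 / 5 := by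
    have h1 : ((k : ℝ) - 1) * h (n + 1 + k) ^ 2 ≤ 1 / β₀ := by
      rw [le_div_iff₀ hβ]
      have := mul_le_mul_of_nonneg_right hkm1 hx2.le
      rw [one_div_mul_cancel hx2.ne'] at this
      linarith
    calc ME * γ * (((k : ℝ) - 1) * h (n + 1 + k) ^ 2) ≤ ME * γ * (1 / β₀) := mul_le_mul_of_nonneg_left h1 (by nlinarith [(hh 0).2, (hh 0).1])
      _ ≤ β₀ / 5 * (1 / β₀) := mul_le_mul_of_nonneg_right hMEγ (by positivity)
      _ = 1 / 5 := by field_simp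
  have hLh : 0 ≤ L k * h (n + 1 + k) := mul_nonneg (hL k) hx.le
  calc L k * h (n + 1 + k) ^ 3 / 2 * (ME * h (n + 1 + k) ^ 3 / 2) * S
      ≤ L k * h (n + 1 + k) ^ 3 / 2 * (ME * γ * h (n + 1 + k) ^ 2 / 2) * (ε1 * h (n + 1) ^ 2 * (((k : ℝ) - 1) * (1 / h (n + 1 + k) ^ 2))) := by
        have hγ0 : 0 ≤ γ := ((hh 0).1.le).trans (hh 0).2
        have hLk := hL k
        apply mul_le_mul (mul_le_mul_of_nonneg_left hMEh (by positivity)) hS' hS0 (by positivity)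
    _ = (L k * h (n + 1 + k) * h (n + 1) ^ 2 * ε1) * (ME * γ * (((k : ℝ) - 1) * h (n + 1 + k) ^ 2)) / 4 := by
        field_simp
        ring
    _ ≤ (L k * h (n + 1 + k) * h (n + 1) ^ 2 * ε1) * (1 / 5) / 4 := by
        apply div_le_div_of_nonneg_right _ (by norm_num)
        exact mul_le_mul_of_nonneg_left hkey (by positivity)
    _ = 1 / 20 * (L k * h (n + 1 + k) * h (n + 1) ^ 2 * ε1) := by ring

end Summit.QuantumFields.BalabanUV.Beta.EriceRemainderEnclosureHistoryAutonomyComparisonNonlinearModulusPrep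

end
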